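import Literature.AlgebraicGeometry.Resolution.RegularLocalRingsJacobian
import Literature.Barriers.ResolutionOfSingularities.RegularNotGeometricallyRegular
import Mathlib.FieldTheory.KummerPolynomial
import Mathlib.FieldTheory.RatFunc.Degree
import Mathlib.RingTheory.AdjoinRoot
import HarnessLib

/-!
# [OURS · L1 W8.2] Kollár's curve `y^q = x^p − t` over `k(t)` for an ARBITRARY field `k` of
# characteristic `p` — the regular inseparable point (support objects for the any-field exponent-zero lemma)

Cell `res-hironaka` (run/shared/lean/pub/res-hironaka/), LADDER-RESOLUTION rung L (RESCUE), slot W8.2, host route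
`UniversalCells`, host item `PrimeFieldToPerfect` (stmt-ResolutionOfSingularities-15233); also door 2
(`UniformComplexity.PrimeModelTransfer`, stmt-8933), whose constant fields `M` are algebraically closed. Written by
the slot's prover res-L1-s82-pv-1 (gen 3). Support OBJECTS (definitions with bodies + proved lemmas), Theses-free.

WHY THIS FILE. The barrier entry `Literature.Barriers.ResolutionOfSingularities.RegularNotGeometricallyRegular`
(Kollár 2007, 1.19; Liu 2002, Ex. 7.3.15) and the sibling files Theorems/UniversalCellsCampaignW82KollarCurve.lean
/ …ExponentZeroProofs.lean work over the FIXED field `𝔽_p(t)` (`baseField p = RatFunc (ZMod p)`), so the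
exponent-zero refutation `not_smoothModelStepRegularAt_zmod_one` is stated at the constant field `M = 𝔽_p` only.
Kollár's 1.19 is printed for `K = k(t)`, "where `k` is ANY field of characteristic `p`" — and the slot's second door
needs algebraically closed `M`. This file re-does the barrier's §1 (the regular inseparable point, via the thick
point `k(t)[x]/((x^p − t)²)`) VERBATIM over `RatFunc k` for an arbitrary field `k`; the proofs are the barrier
entry's, transcribed (credit: that entry); the companions …KollarCurveAnyFieldAlgebra.lean (cusp, base change,
geometric integrality, regular ring, dimension) and …ExponentZeroAnyField.lean (`¬ SmoothModelStepRegularAt k 1` for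
EVERY field `k` of characteristic `p`) build on it.
-- TODO(general form): re-home as Literature/AlgebraicGeometry/PlaneCurves/… (Kollár 1.19 over `k(t)`) if another
-- route wants it; kept summit-side as campaign support to avoid duplicating the barrier entry in Literature/.

CONTENT (`k` a field, `p` prime; `q ≥ 2` an exponent; NO characteristic assumption is needed in this file):
`X_ne_pow` (`t` is not a `p`-th power in `k(t)`), `insepPoly k p = x^p − t` (irreducible), `extField k p = k(t)(t^{1/p})`,
`root_pow_eq`; `kollarPoly k p q = Y^q − X^p + t`, the point `pointIdeal k p = (X^p − t, Y)` (maximal, contains `f`),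
the thick point `thickPoint k p` and `thickLift`, `algebraMap_kollarPoly_not_mem_sq` (`f ∉ 𝔪²`), the curve ring
`kollarRing k p q` with its point `kollarPoint k p q`, and `isRegularLocalRing_kollarPoint` (the local ring there is
regular, Matsumura 14.2 via the tree's `IsRegularLocalRing.quotient_span_singleton`).

HONEST FRAMING. OURS support (witness objects); the mathematics is Kollár 2007, 1.19 / Liu 2002, Ex. 7.3.15 as
already catalogued; nothing here is a statement of H. Hironaka's manuscript [Hironaka2017] and nothing is attributed
to its author. No `sorry`, no new axioms; instances declared are for the new objects only (no Mathlib instance is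
overridden). AI work, weaker than expert review.

## References (locators)
* J. Kollár, *Lectures on Resolution of Singularities* (2007), 1.19 "Curves over nonperfect fields" ("`K = k(t)`,
  where `k` is any field of characteristic `p`"). [Kollar2007]
* Q. Liu, *Algebraic Geometry and Arithmetic Curves* (2002), Example 7.3.15, Remark 4.3.34, Example 3.2.12. [Liu2002]
* H. Matsumura, *Commutative Ring Theory* (1986), Thm. 14.2. [Matsumura1987]
-/

noncomputable section

set_option linter.dupNamespace false -- mandated namespace of this single-conjunct summit

open Polynomial IsLocalRing
open Literature.AlgebraicGeometry.Resolution

namespace Summit.ResolutionOfSingularities.ResolutionOfSingularities.Theorems.CampaignW82.KollarCurveAnyField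

/-! ## §0 `k(t)`, `x^p − t`, `k(t)(t^{1/p})` for an arbitrary field `k` -/

section Field

variable (k : Type) [Field k] (p : ℕ) [hp : Fact p.Prime]

/-- `t ∈ k(t)` is not a `p`-th power (degree count). [folklore] -/
theorem X_ne_pow : ∀ b : RatFunc k, b ^ p ≠ (RatFunc.X : RatFunc k) := by
  intro b hb
  have hb0 : b ≠ 0 := by
    rintro rfl
    rw [zero_pow hp.out.ne_zero] at hb
    exact RatFunc.X_ne_zero hb.symm
  have hdeg : ∀ n : ℕ, RatFunc.intDegree (b ^ n) = n * RatFunc.intDegree b := by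
    intro n
    induction n with
    | zero => simp
    | succ n ih =>
      rw [pow_succ, RatFunc.intDegree_mul (pow_ne_zero n hb0) hb0, ih]
      push_cast
      ring
  have h1 := congrArg RatFunc.intDegree hb
  rw [hdeg, RatFunc.intDegree_X] at h1
  have h2 : (p : ℤ) ∣ 1 := ⟨_, h1.symm⟩
  have h3 : (p : ℤ).natAbs ∣ 1 := by exact_mod_cast Int.natAbs_dvd_natAbs.mpr h2
  simp at h3
  exact hp.out.one_lt.ne' h3

/-- The purely inseparable polynomial `x^p − t ∈ k(t)[x]`. [cite: Liu2002, Example 3.2.12] -/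
abbrev insepPoly : Polynomial (RatFunc k) := X ^ p - C RatFunc.X

/-- `x^p − t` is irreducible over `k(t)` (`t` is not a `p`-th power). [folklore] -/
theorem irreducible_insepPoly : Irreducible (insepPoly k p) :=
  X_pow_sub_C_irreducible_of_prime hp.out (X_ne_pow k p)

/-- Irreducibility of `x^p − t` as a `Fact` instance (so that `AdjoinRoot` is a field). [folklore] -/
instance fact_irreducible_insepPoly : Fact (Irreducible (insepPoly k p)) :=
  ⟨irreducible_insepPoly k p⟩

/-- The purely inseparable extension `K = k(t)[x]/(x^p − t) = k(t)(t^{1/p})` of degree `p`.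
[cite: Liu2002, Example 3.2.12] -/
abbrev extField : Type := AdjoinRoot (insepPoly k p)

/-- `K = k(t)(t^{1/p})` has characteristic `p` when `k` has. [folklore] -/
instance charP_extField [CharP k p] : CharP (extField k p) p :=
  charP_of_injective_algebraMap (algebraMap (RatFunc k) (extField k p)).injective p

/-- `K/k` is finite (power basis `1, x̄, …, x̄^{p−1}` of `AdjoinRoot`). [folklore] -/
instance finiteDimensional_extField : FiniteDimensional (RatFunc k) (extField k p) :=
  PowerBasis.finite (AdjoinRoot.powerBasis (irreducible_insepPoly k p).ne_zero)

/-- `s := x̄` satisfies `s^p = t ∈ k`. [folklore] -/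
theorem root_pow_eq :
    (AdjoinRoot.root (insepPoly k p)) ^ p = algebraMap (RatFunc k) (extField k p) RatFunc.X := by
  have := AdjoinRoot.eval₂_root (insepPoly k p)
  simp only [eval₂_sub, eval₂_X_pow, eval₂_C] at this
  rw [AdjoinRoot.algebraMap_eq]
  exact sub_eq_zero.mp this

end Field

/-! ## §1 Kollár's curve `y^q = x^p − t` over `k(t)` and its regular point `(t^{1/p}, 0)` (the barrier entry's §1,
transcribed for arbitrary `k`) -/

section Kollar

variable (k : Type) [Field k] (p : ℕ) [hp : Fact p.Prime] (q : ℕ) [hq : Fact (1 < q)]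

/-- `f = Y^q − X^p + t ∈ k(t)[X, Y]` (`X = X 0`, `Y = X 1`); `q = 2` is Kollár's hyperelliptic curve
`y² = x^p − t`. [cite: Kollar2007, 1.19 (Curves over nonperfect fields)] -/
def kollarPoly : MvPolynomial (Fin 2) (RatFunc k) :=
  MvPolynomial.X 1 ^ q - MvPolynomial.X 0 ^ p + MvPolynomial.C RatFunc.X

/-- The closed point `(t^{1/p}, 0)` of `𝔸²_k`: the `k`-algebra map `k[X,Y] → K = k(t^{1/p})`,
`X ↦ t^{1/p}`, `Y ↦ 0`. [cite: Kollar2007, 1.19 (Curves over nonperfect fields)] -/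
def pointHom : MvPolynomial (Fin 2) (RatFunc k) →ₐ[RatFunc k] extField k p :=
  MvPolynomial.aeval ![AdjoinRoot.root (insepPoly k p), 0]

/-- Its maximal ideal `𝔮 = (X^p − t, Y) = ker (X ↦ t^{1/p}, Y ↦ 0)` ("over `k` it is defined by
the equations `y = x^p − t = 0`"). [cite: Kollar2007, 1.19 (Curves over nonperfect fields)] -/
def pointIdeal : Ideal (MvPolynomial (Fin 2) (RatFunc k)) := RingHom.ker (pointHom k p)

/-- `X ↦ t^{1/p}`. [folklore] -/
theorem pointHom_X_zero : pointHom k p (MvPolynomial.X 0) = AdjoinRoot.root (insepPoly k p) := by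
  simp [pointHom]

/-- `Y ↦ 0`. [folklore] -/
theorem pointHom_X_one : pointHom k p (MvPolynomial.X 1) = 0 := by
  simp [pointHom]

/-- `k[X,Y] → K` is onto (`K = k[t^{1/p}]`). [folklore] -/
theorem pointHom_surjective : Function.Surjective (pointHom k p) := by
  intro z
  have hz : z ∈ (⊤ : Subalgebra (RatFunc k) (extField k p)) := Algebra.mem_top
  rw [← AdjoinRoot.adjoinRoot_eq_top] at hz
  have hle : Algebra.adjoin (RatFunc k) {AdjoinRoot.root (insepPoly k p)} ≤ (pointHom k p).range := by
    rw [Algebra.adjoin_le_iff, Set.singleton_subset_iff]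
    exact ⟨MvPolynomial.X 0, pointHom_X_zero k p⟩
  obtain ⟨x, hx⟩ := hle hz
  exact ⟨x, hx⟩

/-- `𝔮` is a maximal ideal (a closed point with residue field `K`). [folklore] -/
instance pointIdeal_isMaximal : (pointIdeal k p).IsMaximal :=
  RingHom.ker_isMaximal_of_surjective (pointHom k p) (pointHom_surjective k p)

/-- The point lies on the curve: `f(t^{1/p}, 0) = 0 − t + t = 0`. [cite: Kollar2007, 1.19 (Curves
over nonperfect fields)] -/
theorem pointHom_kollarPoly : pointHom k p (kollarPoly k p q) = 0 := by
  have hq0 : q ≠ 0 := by have := hq.out; omega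
  simp [pointHom, kollarPoly, root_pow_eq, zero_pow hq0]

/-- `f ∈ 𝔮`. [folklore] -/
theorem kollarPoly_mem_pointIdeal : kollarPoly k p q ∈ pointIdeal k p := pointHom_kollarPoly k p q

/-- `(f) ≤ 𝔮`. [folklore] -/
theorem span_kollarPoly_le : Ideal.span {kollarPoly k p q} ≤ pointIdeal k p :=
  (Ideal.span_singleton_le_iff_mem _).mpr (kollarPoly_mem_pointIdeal k p q)

/-! ### The thick point `T = k[x]/((x^p − t)²)` detects `f ∈ 𝔪 ∖ 𝔪²` (no derivation can: `∂(x^p − t) = 0`) -/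

/-- `T = k[x]/((x^p − t)²)`, an Artinian local `k`-algebra with residue field `K`. [folklore] -/
abbrev thickPoint : Type := AdjoinRoot ((insepPoly k p) ^ 2)

/-- `ψ : k[X,Y] → T`, `X ↦ x̄`, `Y ↦ 0`. [folklore] -/
def thickHom : MvPolynomial (Fin 2) (RatFunc k) →ₐ[RatFunc k] thickPoint k p :=
  MvPolynomial.aeval ![AdjoinRoot.root ((insepPoly k p) ^ 2), 0]

/-- The reduction `π : T → K`, `x̄ ↦ t^{1/p}`. [folklore] -/
def thickToExt : thickPoint k p →ₐ[RatFunc k] extField k p :=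
  AdjoinRoot.algHomOfDvd (RatFunc k) ((insepPoly k p) ^ 2) (insepPoly k p)
    (dvd_pow_self _ two_ne_zero)

/-- `π` on representatives. [folklore] -/
theorem thickToExt_mk (w : Polynomial (RatFunc k)) :
    thickToExt k p (AdjoinRoot.mk _ w) = AdjoinRoot.mk (insepPoly k p) w := by
  rw [thickToExt, AdjoinRoot.coe_algHomOfDvd, AdjoinRoot.liftAlgHom_mk, ← AdjoinRoot.aeval_eq,
    Polynomial.aeval_def]
  rfl

/-- `π(x̄) = t^{1/p}`. [folklore] -/
theorem thickToExt_root : thickToExt k p (AdjoinRoot.root _) = AdjoinRoot.root (insepPoly k p) := by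
  have := thickToExt_mk k p X
  simpa using this

/-- `π ∘ ψ` is the point `(t^{1/p}, 0)`. [folklore] -/
theorem thickToExt_comp_thickHom : (thickToExt k p).comp (thickHom k p) = pointHom k p := by
  apply MvPolynomial.algHom_ext
  intro i
  fin_cases i
  · simp [thickHom, pointHom, thickToExt_root]
  · simp [thickHom, pointHom]

omit hp in
/-- `x̄^p − t` is the class of `x^p − t` in `T`. [folklore] -/
theorem mk_insepPoly_eq : AdjoinRoot.mk ((insepPoly k p) ^ 2) (insepPoly k p) =
    AdjoinRoot.root ((insepPoly k p) ^ 2) ^ p -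
      algebraMap (RatFunc k) (thickPoint k p) RatFunc.X := by
  rw [← AdjoinRoot.aeval_eq]
  simp [insepPoly]

omit hp in
/-- `ψ(f) = −(x̄^p − t)`, the class of `−(x^p − t)` in `T`. [folklore] -/
theorem thickHom_kollarPoly :
    thickHom k p (kollarPoly k p q) = - AdjoinRoot.mk ((insepPoly k p) ^ 2) (insepPoly k p) := by
  have hq0 : q ≠ 0 := by have := hq.out; omega
  have h1 : thickHom k p (kollarPoly k p q) = 0 ^ q - AdjoinRoot.root ((insepPoly k p) ^ 2) ^ p +
      algebraMap (RatFunc k) (thickPoint k p) RatFunc.X := by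
    simp [thickHom, kollarPoly]
  rw [h1, mk_insepPoly_eq, zero_pow hq0]
  ring

/-- … which is non-zero in `T` (`(x^p − t)²` does not divide `x^p − t`). [folklore] -/
theorem mk_insepPoly_ne_zero : AdjoinRoot.mk ((insepPoly k p) ^ 2) (insepPoly k p) ≠ 0 := by
  rw [Ne, AdjoinRoot.mk_eq_zero]
  rintro ⟨c, hc⟩
  have hg0 : insepPoly k p ≠ 0 := (irreducible_insepPoly k p).ne_zero
  have h1 : insepPoly k p * 1 = insepPoly k p * (insepPoly k p * c) := by
    rw [mul_one, ← mul_assoc, ← pow_two]; exact hc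
  have h2 : (1 : Polynomial (RatFunc k)) = insepPoly k p * c := mul_left_cancel₀ hg0 h1
  exact (irreducible_insepPoly k p).not_isUnit (IsUnit.of_mul_eq_one c h2.symm)

/-- Elements of `k[X,Y]` outside `𝔮` become units in `T` (`x^p − t` irreducible, Bézout).
[folklore] -/
theorem isUnit_thickHom {u : MvPolynomial (Fin 2) (RatFunc k)} (hu : u ∉ pointIdeal k p) :
    IsUnit (thickHom k p u) := by
  obtain ⟨w, hw⟩ := AdjoinRoot.mk_surjective (thickHom k p u)
  have hne : AdjoinRoot.mk (insepPoly k p) w ≠ 0 := by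
    intro h0
    apply hu
    change pointHom k p u = 0
    rw [← thickToExt_comp_thickHom, AlgHom.comp_apply, ← hw, thickToExt_mk, h0]
  have hndvd : ¬ insepPoly k p ∣ w := by rwa [← AdjoinRoot.mk_eq_zero]
  have hcop : IsCoprime (insepPoly k p) w :=
    ((irreducible_insepPoly k p).coprime_iff_not_dvd).mpr hndvd
  obtain ⟨a, b, hab⟩ := hcop.pow_left (m := 2)
  rw [← hw]
  have h1 := congrArg (AdjoinRoot.mk ((insepPoly k p) ^ 2)) hab
  rw [map_add, map_mul, map_mul, AdjoinRoot.mk_self, mul_zero, zero_add, map_one] at h1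
  exact IsUnit.of_mul_eq_one (AdjoinRoot.mk _ b) (by rw [mul_comm]; exact h1)

/-- `ψ̃ : k[X,Y]_𝔮 → T`, the extension of `ψ` to the regular local ring `k[X,Y]_𝔮`. [folklore] -/
def thickLift : Localization.AtPrime (pointIdeal k p) →+* thickPoint k p :=
  IsLocalization.lift (M := (pointIdeal k p).primeCompl) (S := Localization.AtPrime (pointIdeal k p))
    (g := (thickHom k p).toRingHom) (fun y => isUnit_thickHom k p y.prop)

/-- `ψ̃` extends `ψ`. [folklore] -/
theorem thickLift_algebraMap (x : MvPolynomial (Fin 2) (RatFunc k)) :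
    thickLift k p (algebraMap _ _ x) = thickHom k p x :=
  IsLocalization.lift_eq _ x

/-- `ψ(𝔮) ⊆ (x̄^p − t) T`. [folklore] -/
theorem thickHom_mem_of_mem_pointIdeal {x : MvPolynomial (Fin 2) (RatFunc k)}
    (hx : x ∈ pointIdeal k p) :
    thickHom k p x ∈ Ideal.span {AdjoinRoot.mk ((insepPoly k p) ^ 2) (insepPoly k p)} := by
  obtain ⟨w, hw⟩ := AdjoinRoot.mk_surjective (thickHom k p x)
  have h0 : AdjoinRoot.mk (insepPoly k p) w = 0 := by
    rw [← thickToExt_mk, hw, ← AlgHom.comp_apply, thickToExt_comp_thickHom]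
    exact hx
  obtain ⟨w', rfl⟩ := AdjoinRoot.mk_eq_zero.mp h0
  rw [← hw, map_mul]
  exact Ideal.mul_mem_right _ _ (Ideal.subset_span rfl)

/-- `ψ̃(𝔪) ⊆ (x̄^p − t) T` for the maximal ideal `𝔪 = 𝔮 k[X,Y]_𝔮`. [folklore] -/
theorem map_maximalIdeal_thickLift_le :
    (maximalIdeal (Localization.AtPrime (pointIdeal k p))).map (thickLift k p) ≤
      Ideal.span {AdjoinRoot.mk ((insepPoly k p) ^ 2) (insepPoly k p)} := by
  rw [← Localization.AtPrime.map_eq_maximalIdeal, Ideal.map_map, Ideal.map_le_iff_le_comap]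
  intro x hx
  rw [Ideal.mem_comap, RingHom.comp_apply, thickLift_algebraMap]
  exact thickHom_mem_of_mem_pointIdeal k p hx

/-- `ψ̃` kills `𝔪²` (`((x^p − t)²) = 0` in `T`). [folklore] -/
theorem thickLift_eq_zero_of_mem_sq {z : Localization.AtPrime (pointIdeal k p)}
    (hz : z ∈ (maximalIdeal (Localization.AtPrime (pointIdeal k p))) ^ 2) :
    thickLift k p z = 0 := by
  have h1 : thickLift k p z ∈
      ((maximalIdeal (Localization.AtPrime (pointIdeal k p))).map (thickLift k p)) ^ 2 := by
    rw [← Ideal.map_pow]; exact Ideal.mem_map_of_mem _ hz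
  have h2 := Ideal.pow_right_mono (map_maximalIdeal_thickLift_le k p) 2 h1
  rw [Ideal.span_singleton_pow, ← map_pow, AdjoinRoot.mk_self,
    Ideal.span_singleton_eq_bot.mpr rfl] at h2
  exact h2

/-- `f ∈ 𝔪`. [folklore] -/
theorem algebraMap_kollarPoly_mem :
    algebraMap _ (Localization.AtPrime (pointIdeal k p)) (kollarPoly k p q) ∈ maximalIdeal _ := by
  rw [← Localization.AtPrime.map_eq_maximalIdeal]
  exact Ideal.mem_map_of_mem _ (kollarPoly_mem_pointIdeal k p q)

/-- **`f ∉ 𝔪²`** in `k[X,Y]_𝔮` (`ψ̃(f) = −(x̄^p − t) ≠ 0` while `ψ̃(𝔪²) = 0`): the content of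
"the maximal ideal … is generated by `y` alone". [cite: Kollar2007, 1.19 (Curves over nonperfect
fields)] -/
theorem algebraMap_kollarPoly_not_mem_sq :
    algebraMap _ (Localization.AtPrime (pointIdeal k p)) (kollarPoly k p q) ∉ (maximalIdeal _) ^ 2 := by
  intro h
  have h0 := thickLift_eq_zero_of_mem_sq k p h
  rw [thickLift_algebraMap, thickHom_kollarPoly, neg_eq_zero] at h0
  exact mk_insepPoly_ne_zero k p h0

/-- The coordinate ring `A = k[X,Y]/(Y^q − X^p + t)` of the curve `C`. [cite: Kollar2007, 1.19
(Curves over nonperfect fields)] -/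
abbrev kollarRing : Type := MvPolynomial (Fin 2) (RatFunc k) ⧸ Ideal.span {kollarPoly k p q}

/-- The closed point `P = (t^{1/p}, 0) ∈ C`: the prime `𝔭 = 𝔮/(f)` of `A`. [cite: Kollar2007,
1.19 (Curves over nonperfect fields)] -/
abbrev kollarPoint : Ideal (kollarRing k p q) := (pointIdeal k p).map (Ideal.Quotient.mk _)

/-- `𝔭` is prime. [folklore] -/
instance kollarPoint_isPrime : (kollarPoint k p q).IsPrime :=
  Literature.Barriers.ResolutionOfSingularities.isPrime_map_mk_of_le (Ideal.span {kollarPoly k p q}) _ (span_kollarPoly_le k p q)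

/-- `𝔭` is maximal. [folklore] -/
theorem kollarPoint_isMaximal : (kollarPoint k p q).IsMaximal := by
  rcases Ideal.map_eq_top_or_isMaximal_of_surjective
    (Ideal.Quotient.mk (Ideal.span {kollarPoly k p q})) Ideal.Quotient.mk_surjective
    (pointIdeal_isMaximal k p) with h | h
  · exfalso
    have := congrArg (Ideal.comap (Ideal.Quotient.mk (Ideal.span {kollarPoly k p q}))) h
    rw [Literature.Barriers.ResolutionOfSingularities.comap_map_mk_eq_of_le _ _ (span_kollarPoly_le k p q), Ideal.comap_top] at this
    exact (pointIdeal_isMaximal k p).ne_top this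
  · exact h

/-- **Kollár 2007, 1.19, first half (proved): `C` is regular at `P`** — the local ring `A_𝔭` of
`y^q = x^p − t` at `(t^{1/p}, 0)` is a regular local ring, being `k[X,Y]_𝔮/(f)` with
`f ∈ 𝔪 ∖ 𝔪²` (Matsumura 14.2). [cite: Kollar2007, 1.19 (Curves over nonperfect fields)]
[cite: Matsumura1987, Thm. 14.2] -/
theorem isRegularLocalRing_kollarPoint :
    IsRegularLocalRing (Localization.AtPrime (kollarPoint k p q)) := by
  apply Literature.Barriers.ResolutionOfSingularities.isRegularLocalRing_localization_map_mk (Ideal.span {kollarPoly k p q}) (pointIdeal k p)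
    (span_kollarPoly_le k p q)
  have hmap : (Ideal.span {kollarPoly k p q}).map
      (algebraMap _ (Localization.AtPrime (pointIdeal k p))) =
      Ideal.span {algebraMap _ (Localization.AtPrime (pointIdeal k p)) (kollarPoly k p q)} := by
    rw [Ideal.map_span, Set.image_singleton]
  rw [hmap]
  exact (IsRegularLocalRing.quotient_span_singleton (algebraMap_kollarPoly_mem k p q)
    (algebraMap_kollarPoly_not_mem_sq k p q)).1


end Kollar

end Summit.ResolutionOfSingularities.ResolutionOfSingularities.Theorems.CampaignW82.KollarCurveAnyField

end
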